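import Summits.AtomisticToContinuum.FouriersLaw.Theorems.BondHeatUncertaintyExtensiveSnapshotIrreversibilityEnergyWindowOddMomentA

/-!
# Crux `ExtensiveSnapshotIrreversibility` (stmt-AtomisticToContinuum-9121), fixed-`N` half `K_fix`:
the DIVERGENCE LADDER — pointwise sandwich and one-state seam (node «DivergenceLadder», 1/6)

(helper file, theorem-side; decomp-a2c lens-1 «grading / quantitative ladder», generation 89.)

The second-order snapshot irreversibility `KL(μ_δ ‖ Θ_*μ_δ) ≈ ½ D δ²` can be measured in any
`f`-divergence; they differ only in their SENSITIVITY TO THE TAILS of the odd log-ratio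
`ψ := log dμ_δ/dΘ_*μ_δ`.  For a tilt `μ = μ₀ · e^{φ}` of a flip-invariant probability measure `μ₀`
(`ψ = φ − φ∘Θ`, `f = e^{φ}`, `f̃ = e^{φ∘Θ}`) the KL integrand and the TRIANGULAR-DISCRIMINATION
(Vincze–Le Cam) integrand are, pointwise,

  `k = ½ ψ (f − f̃)`,   `t = (f − f̃)² / (f + f̃)`,   `k = (ψ/2) coth(ψ/2) · t`,

so `t ≤ k ≤ (1 + |ψ|/2) t` (`tanh x ≤ x`, `1 + x ≤ eˣ`; §1).  Consequences, one tilted state (§2):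

* `toReal_klDiv_flip_tilted_eq_half_integral` — `KL(μ ‖ Θ_*μ) = ½ ∫ ψ (f − f̃) dμ₀` once
  `ψ f ∈ L¹(μ₀)`;
* `integral_triangular_le_toReal_klDiv` — NECESSITY: `Δ(μ, Θ_*μ) := ∫ t dμ₀ ≤ KL(μ ‖ Θ_*μ)`
  whenever the right side is finite (the triangular integrand is always integrable, `t ≤ f + f̃`);
* `toReal_klDiv_flip_tilted_le_triangular` — SUFFICIENCY at level `η > 0`:
  `KL ≤ (1 + η/2) Δ + ∫_{|ψ| > η} |ψ| f dμ₀` (split at the flip-symmetric level set).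

The filter form along a family (moment + concentration + `Δ ≤ D'δ²` ⟹ `KL ≤ Kδ²`) is in
`…EnergyWindowDivergenceFilter`; the NESS atoms and the record junction in
`…EnergyWindowDivergenceAtoms`; the rungs in `…EnergyWindowDivergenceRungs`.

No new objects. [folklore]  References: F. Topsøe, IEEE Trans. Inform. Theory 46 (2000) 1602–1609
(triangular discrimination, `Δ ≤ KL`-type bounds); L. Le Cam, Asymptotic Methods in Statistical
Decision Theory (1986) §17.3; I. Vincze, in: Coll. Math. Soc. J. Bolyai 36 (1981).
-/

noncomputable section

namespace Summit.AtomisticToContinuum.FouriersLaw.Theorems.ExtensiveSnapshotIrreversibility.EnergyWindow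

open MeasureTheory Filter Topology InformationTheory Real
open scoped ENNReal NNReal
open Literature.MathematicalPhysics.KineticTheory.HeatConduction
open Summit.AtomisticToContinuum.FouriersLaw.Theorems.ExtensiveSnapshotIrreversibility.Negative
open Summit.AtomisticToContinuum.FouriersLaw.Theorems.ExtensiveSnapshotIrreversibility.ClausiusBudget.OddLogDensity

variable {N : ℕ}

/-! ## 1. Pointwise: the KL integrand against the triangular integrand -/

/-- `2 (eᵘ − 1) ≤ u (eᵘ + 1)` for `u ≥ 0` (`tanh(u/2) ≤ u/2`; the derivative of the difference is
`u eᵘ − eᵘ + 1 ≥ 0`). [folklore; a `private` copy with the same statement sits in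
`Literature/Probability/LatticeModels/DobrushinTiltSharp.lean` and is not importable by name] -/
theorem two_mul_exp_sub_one_le {u : ℝ} (hu : 0 ≤ u) : 2 * (exp u - 1) ≤ u * (exp u + 1) := by
  have hmono : MonotoneOn (fun t : ℝ => t * (exp t + 1) - 2 * (exp t - 1)) (Set.Ici 0) := by
    refine monotoneOn_of_deriv_nonneg (convex_Ici 0) ?_ ?_ fun t ht => ?_
    · exact ((continuous_id.mul (continuous_exp.add continuous_const)).sub
        (continuous_const.mul (continuous_exp.sub continuous_const))).continuousOn
    · intro t _
      exact (((hasDerivAt_id' t).mul ((hasDerivAt_exp t).add_const 1)).sub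
        (((hasDerivAt_exp t).sub_const 1).const_mul 2)).differentiableAt.differentiableWithinAt
    · rw [interior_Ici, Set.mem_Ioi] at ht
      have hd : HasDerivAt (fun t : ℝ => t * (exp t + 1) - 2 * (exp t - 1))
          (1 * (exp t + 1) + t * exp t - 2 * exp t) t :=
        ((hasDerivAt_id' t).mul ((hasDerivAt_exp t).add_const 1)).sub
          (((hasDerivAt_exp t).sub_const 1).const_mul 2)
      rw [hd.deriv]
      have h1 : -t + 1 ≤ exp (-t) := Real.add_one_le_exp (-t)
      have h2 : exp (-t) * exp t = 1 := by rw [← exp_add]; simp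
      nlinarith [exp_pos t, exp_pos (-t), mul_le_mul_of_nonneg_right h1 (exp_pos t).le]
  have h := hmono (Set.mem_Ici.2 le_rfl) (Set.mem_Ici.2 hu) hu
  simp only [zero_mul, exp_zero, sub_self, mul_zero] at h
  linarith

/-- The two comparisons for `b ≤ a`: with `t = (eᵃ − eᵇ)²/(eᵃ + eᵇ)` and `k = ½ (a − b)(eᵃ − eᵇ)`,
`t ≤ k ≤ (1 + (a − b)/2) t`. [folklore] -/
theorem triangular_sandwich_of_le {a b : ℝ} (hab : b ≤ a) :
    (exp a - exp b) ^ 2 / (exp a + exp b) ≤ (a - b) * (exp a - exp b) / 2 ∧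
      (a - b) * (exp a - exp b) / 2 ≤
        (1 + (a - b) / 2) * ((exp a - exp b) ^ 2 / (exp a + exp b)) := by
  have hu : 0 ≤ a - b := sub_nonneg.2 hab
  have hS : 0 < exp a + exp b := by positivity
  have hb : 0 < exp b := exp_pos b
  have hV : exp a = exp b * exp (a - b) := by rw [← exp_add]; congr 1; ring
  have hV1 : 1 ≤ exp (a - b) := Real.one_le_exp hu
  have hVu : a - b + 1 ≤ exp (a - b) := Real.add_one_le_exp (a - b)
  have key := two_mul_exp_sub_one_le hu
  have hnn : 0 ≤ exp b * exp b * (exp (a - b) - 1) := by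
    have : 0 ≤ exp (a - b) - 1 := by linarith
    positivity
  constructor
  · rw [div_le_iff₀ hS, hV]
    nlinarith [mul_le_mul_of_nonneg_left key hnn]
  · rw [← mul_div_assoc, le_div_iff₀ hS, hV]
    have h3 : 0 ≤ exp b * exp b * (exp (a - b) - 1) * (exp (a - b) - 1 - (a - b)) :=
      mul_nonneg hnn (by linarith)
    nlinarith [h3]

/-- **`t ≤ k`**: `(eᵃ − eᵇ)²/(eᵃ + eᵇ) ≤ ½ (a − b)(eᵃ − eᵇ)` (logarithmic mean ≤ arithmetic mean of
`eᵃ, eᵇ`). [folklore] -/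
theorem triangular_le_half_sub_mul (a b : ℝ) :
    (exp a - exp b) ^ 2 / (exp a + exp b) ≤ (a - b) * (exp a - exp b) / 2 := by
  rcases le_total b a with h | h
  · exact (triangular_sandwich_of_le h).1
  · have h' := (triangular_sandwich_of_le h).1
    have e1 : (exp b - exp a) ^ 2 = (exp a - exp b) ^ 2 := by ring
    have e2 : exp b + exp a = exp a + exp b := by ring
    have e3 : (b - a) * (exp b - exp a) = (a - b) * (exp a - exp b) := by ring
    rwa [e1, e2, e3] at h'

/-- **`k ≤ (1 + |a − b|/2) t`**: `½ (a − b)(eᵃ − eᵇ) ≤ (1 + |a − b|/2) (eᵃ − eᵇ)²/(eᵃ + eᵇ)`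
(`1 + x ≤ eˣ`). [folklore] -/
theorem half_sub_mul_le_triangular (a b : ℝ) :
    (a - b) * (exp a - exp b) / 2 ≤
      (1 + |a - b| / 2) * ((exp a - exp b) ^ 2 / (exp a + exp b)) := by
  rcases le_total b a with h | h
  · rw [abs_of_nonneg (sub_nonneg.2 h)]
    exact (triangular_sandwich_of_le h).2
  · have h' := (triangular_sandwich_of_le h).2
    rw [abs_of_nonpos (sub_nonpos.2 h)]
    have e1 : (exp b - exp a) ^ 2 = (exp a - exp b) ^ 2 := by ring
    have e2 : exp b + exp a = exp a + exp b := by ring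
    have e3 : (b - a) * (exp b - exp a) = (a - b) * (exp a - exp b) := by ring
    have e4 : b - a = -(a - b) := by ring
    rwa [e1, e2, e3, e4] at h'

/-- **Tail form** `½ (a − b)(eᵃ − eᵇ) ≤ ½ |a − b| (eᵃ + eᵇ)`. [folklore] -/
theorem half_sub_mul_le_abs_mul_add (a b : ℝ) :
    (a - b) * (exp a - exp b) / 2 ≤ |a - b| * (exp a + exp b) / 2 := by
  have h1 : (a - b) * (exp a - exp b) ≤ |a - b| * |exp a - exp b| := by
    rw [← abs_mul]; exact le_abs_self _
  have h2 : |exp a - exp b| ≤ exp a + exp b :=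
    abs_sub_le_iff.2 ⟨by linarith [exp_pos b], by linarith [exp_pos a]⟩
  nlinarith [mul_le_mul_of_nonneg_left h2 (abs_nonneg (a - b))]

/-- `t ≤ eᵃ + eᵇ`. [folklore] -/
theorem triangular_le_add (a b : ℝ) : (exp a - exp b) ^ 2 / (exp a + exp b) ≤ exp a + exp b := by
  rw [div_le_iff₀ (by positivity)]
  nlinarith [exp_pos a, exp_pos b]

/-- `0 ≤ t`. [folklore] -/
theorem triangular_nonneg (a b : ℝ) : 0 ≤ (exp a - exp b) ^ 2 / (exp a + exp b) := by positivity

/-! ## 2. One tilted state: the value of the divergence, necessity, and the level-set bound -/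

section OneState

variable (μ₀ : Measure (PhaseSpace N))

/-- The triangular integrand of a tilt `μ₀ · e^{φ}` (`e^{φ} ∈ L¹(μ₀)`) is `μ₀`-integrable
(`0 ≤ t ≤ e^{φ} + e^{φ∘Θ}`, flip-invariance of `μ₀`). [folklore] -/
theorem integrable_triangular (hinv : μ₀.map (fun x : PhaseSpace N => (x.1, -x.2)) = μ₀)
    {φ : PhaseSpace N → ℝ} (hφm : Measurable φ) (hexp : Integrable (fun x => exp (φ x)) μ₀) :
    Integrable (fun x => (exp (φ x) - exp (φ (x.1, -x.2))) ^ 2 /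
      (exp (φ x) + exp (φ (x.1, -x.2)))) μ₀ := by
  have hΘm : Measurable (fun x : PhaseSpace N => (x.1, -x.2)) := (momentumReversal N).measurable
  have hexp' : Integrable (fun x => exp (φ (x.1, -x.2))) μ₀ :=
    (integrable_comp_flip_iff μ₀ hinv (fun x => exp (φ x))).2 hexp
  refine (hexp.add hexp').mono' ?_ (ae_of_all _ fun x => ?_)
  · exact (((hφm.exp.sub (hφm.comp hΘm).exp).pow_const 2).div
      (hφm.exp.add (hφm.comp hΘm).exp)).aestronglyMeasurable
  · rw [Real.norm_eq_abs, abs_of_nonneg (triangular_nonneg _ _)]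
    exact triangular_le_add _ _

variable [IsProbabilityMeasure μ₀]

/-- **The value, symmetrised.** For a tilt `μ = μ₀ · e^{φ}` (`∫ e^{φ} dμ₀ = 1`) of a flip-invariant
probability measure with `ψ e^{φ} ∈ L¹(μ₀)` (`ψ = φ − φ∘Θ`): `KL(μ ‖ Θ_*μ)` is finite and equals
`½ ∫ ψ (e^{φ} − e^{φ∘Θ}) dμ₀`. [folklore] -/
theorem toReal_klDiv_flip_tilted_eq_half_integral
    (hinv : μ₀.map (fun x : PhaseSpace N => (x.1, -x.2)) = μ₀)
    {φ : PhaseSpace N → ℝ} (hφm : Measurable φ) (hexp : Integrable (fun x => exp (φ x)) μ₀)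
    (hZ1 : ∫ x, exp (φ x) ∂μ₀ = 1)
    (hw : Integrable (fun x => (φ x - φ (x.1, -x.2)) * exp (φ x)) μ₀) :
    klDiv (μ₀.tilted φ) ((μ₀.tilted φ).map (fun x : PhaseSpace N => (x.1, -x.2))) ≠ ∞ ∧
      (klDiv (μ₀.tilted φ) ((μ₀.tilted φ).map (fun x : PhaseSpace N => (x.1, -x.2)))).toReal =
        (1 / 2 : ℝ) * ∫ x, (φ x - φ (x.1, -x.2)) * (exp (φ x) - exp (φ (x.1, -x.2))) ∂μ₀ := by
  set ψ : PhaseSpace N → ℝ := fun x => φ x - φ (x.1, -x.2) with hψ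
  have hψodd : ∀ x : PhaseSpace N, ψ (x.1, -x.2) = -ψ x := fun x => by simp [hψ]
  have hψL1 : Integrable ψ (μ₀.tilted φ) := by
    rw [integrable_tilted_iff hexp]
    refine hw.congr (ae_of_all _ fun x => ?_)
    simp only [smul_eq_mul, hψ]
    ring
  refine ⟨(klDiv_flip_tilted_ne_top_iff hinv hφm hexp).2 hψL1, ?_⟩
  rw [toReal_klDiv_flip_tilted hinv hφm hexp, integral_tilted]
  have e1 : ∫ x, (exp (φ x) / ∫ x, exp (φ x) ∂μ₀) • ψ x ∂μ₀ = ∫ x, ψ x * exp (φ x) ∂μ₀ := by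
    refine integral_congr_ae (ae_of_all _ fun x => ?_)
    simp only [hZ1, div_one, smul_eq_mul]
    ring
  -- the flipped weight: `∫ ψ e^{φ∘Θ} dμ₀ = −∫ ψ e^{φ} dμ₀`
  have hw' : Integrable (fun x => ψ x * exp (φ (x.1, -x.2))) μ₀ := by
    have h := (integrable_comp_flip_iff μ₀ hinv (fun x => -(ψ x * exp (φ x)))).2 hw.neg
    refine h.congr (ae_of_all _ fun x => ?_)
    simp only [hψodd x]
    ring
  have hI : ∫ x, ψ x * exp (φ (x.1, -x.2)) ∂μ₀ = -∫ x, ψ x * exp (φ x) ∂μ₀ := by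
    rw [← integral_neg, ← integral_comp_flip μ₀ hinv (fun x => -(ψ x * exp (φ x)))]
    refine integral_congr_ae (ae_of_all _ fun x => ?_)
    simp only [hψodd x]
    ring
  have e2 : ∫ x, ψ x * (exp (φ x) - exp (φ (x.1, -x.2))) ∂μ₀ =
      ∫ x, ψ x * exp (φ x) ∂μ₀ - ∫ x, ψ x * exp (φ (x.1, -x.2)) ∂μ₀ := by
    rw [← integral_sub hw hw']
    refine integral_congr_ae (ae_of_all _ fun x => ?_)
    ring
  change ∫ x, (exp (φ x) / ∫ x, exp (φ x) ∂μ₀) • ψ x ∂μ₀ =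
    (1 / 2 : ℝ) * ∫ x, ψ x * (exp (φ x) - exp (φ (x.1, -x.2))) ∂μ₀
  rw [e1, e2, hI]
  ring

/-- **NECESSITY `Δ ≤ KL`.** For a tilt `μ = μ₀ · e^{φ}` (`∫ e^{φ} dμ₀ = 1`) of a flip-invariant
probability measure: if `KL(μ ‖ Θ_*μ) < ∞` then
`∫ (e^{φ} − e^{φ∘Θ})²/(e^{φ} + e^{φ∘Θ}) dμ₀ ≤ KL(μ ‖ Θ_*μ)` (pointwise `t ≤ k`). [folklore] -/
theorem integral_triangular_le_toReal_klDiv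
    (hinv : μ₀.map (fun x : PhaseSpace N => (x.1, -x.2)) = μ₀)
    {φ : PhaseSpace N → ℝ} (hφm : Measurable φ) (hexp : Integrable (fun x => exp (φ x)) μ₀)
    (hZ1 : ∫ x, exp (φ x) ∂μ₀ = 1)
    (hfin : klDiv (μ₀.tilted φ) ((μ₀.tilted φ).map (fun x : PhaseSpace N => (x.1, -x.2))) ≠ ∞) :
    ∫ x, (exp (φ x) - exp (φ (x.1, -x.2))) ^ 2 / (exp (φ x) + exp (φ (x.1, -x.2))) ∂μ₀ ≤
      (klDiv (μ₀.tilted φ) ((μ₀.tilted φ).map (fun x : PhaseSpace N => (x.1, -x.2)))).toReal := by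
  have hψL1 : Integrable (fun x => φ x - φ (x.1, -x.2)) (μ₀.tilted φ) :=
    (klDiv_flip_tilted_ne_top_iff hinv hφm hexp).1 hfin
  have hw : Integrable (fun x => (φ x - φ (x.1, -x.2)) * exp (φ x)) μ₀ := by
    rw [integrable_tilted_iff hexp] at hψL1
    refine hψL1.congr (ae_of_all _ fun x => ?_)
    simp only [smul_eq_mul]
    ring
  rw [(toReal_klDiv_flip_tilted_eq_half_integral μ₀ hinv hφm hexp hZ1 hw).2, ← integral_const_mul]
  have hexp' : Integrable (fun x => exp (φ (x.1, -x.2))) μ₀ :=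
    (integrable_comp_flip_iff μ₀ hinv (fun x => exp (φ x))).2 hexp
  have hw' : Integrable (fun x => (φ x - φ (x.1, -x.2)) * exp (φ (x.1, -x.2))) μ₀ := by
    have h := (integrable_comp_flip_iff μ₀ hinv (fun x => -((φ x - φ (x.1, -x.2)) * exp (φ x)))).2
      hw.neg
    refine h.congr (ae_of_all _ fun x => ?_)
    simp only [neg_neg]
    ring
  refine integral_mono (integrable_triangular μ₀ hinv hφm hexp) ?_ fun x => ?_
  · refine ((hw.sub hw').const_mul (1 / 2 : ℝ)).congr (ae_of_all _ fun x => ?_)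
    simp only [Pi.sub_apply]
    ring
  · have := triangular_le_half_sub_mul (φ x) (φ (x.1, -x.2))
    simp only at this ⊢
    linarith

/-- **SUFFICIENCY, one state: the level-set bound.** For a tilt `μ = μ₀ · e^{φ}` (`∫ e^{φ} dμ₀ = 1`)
of a flip-invariant probability measure with `|ψ| e^{φ} ∈ L¹(μ₀)` and every level `η > 0`:
`KL(μ ‖ Θ_*μ) ≤ (1 + η/2) ∫ t dμ₀ + ∫_{|ψ| > η} |ψ| e^{φ} dμ₀` (pointwise `k ≤ (1 + |ψ|/2) t` on
`{|ψ| ≤ η}`, `k ≤ ½|ψ|(e^{φ} + e^{φ∘Θ})` off it; the level set is flip-symmetric). [folklore] -/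
theorem toReal_klDiv_flip_tilted_le_triangular
    (hinv : μ₀.map (fun x : PhaseSpace N => (x.1, -x.2)) = μ₀)
    {φ : PhaseSpace N → ℝ} (hφm : Measurable φ) (hexp : Integrable (fun x => exp (φ x)) μ₀)
    (hZ1 : ∫ x, exp (φ x) ∂μ₀ = 1) {η : ℝ} (hη : 0 < η)
    (h1 : Integrable (fun x => |φ x - φ (x.1, -x.2)| * exp (φ x)) μ₀) :
    klDiv (μ₀.tilted φ) ((μ₀.tilted φ).map (fun x : PhaseSpace N => (x.1, -x.2))) ≠ ∞ ∧
      (klDiv (μ₀.tilted φ) ((μ₀.tilted φ).map (fun x : PhaseSpace N => (x.1, -x.2)))).toReal ≤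
        (1 + η / 2) * ∫ x, (exp (φ x) - exp (φ (x.1, -x.2))) ^ 2 /
            (exp (φ x) + exp (φ (x.1, -x.2))) ∂μ₀ +
          ∫ x in {x | η < |φ x - φ (x.1, -x.2)|}, |φ x - φ (x.1, -x.2)| * exp (φ x) ∂μ₀ := by
  set ψ : PhaseSpace N → ℝ := fun x => φ x - φ (x.1, -x.2) with hψ
  have hΘm : Measurable (fun x : PhaseSpace N => (x.1, -x.2)) := (momentumReversal N).measurable
  have hψm : Measurable ψ := hφm.sub (hφm.comp hΘm)
  have hψodd : ∀ x : PhaseSpace N, ψ (x.1, -x.2) = -ψ x := fun x => by simp [hψ]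
  have hexp' : Integrable (fun x => exp (φ (x.1, -x.2))) μ₀ :=
    (integrable_comp_flip_iff μ₀ hinv (fun x => exp (φ x))).2 hexp
  set A : Set (PhaseSpace N) := {x | η < |ψ x|} with hA
  have hAm : MeasurableSet A := measurableSet_lt measurable_const hψm.abs
  have hAΘ : ∀ x : PhaseSpace N, ((x.1, -x.2) ∈ A) = (x ∈ A) := fun x => by
    simp only [hA, Set.mem_setOf_eq, hψodd x, abs_neg]
  -- integrability
  have hw : Integrable (fun x => ψ x * exp (φ x)) μ₀ := by
    refine h1.mono' (hψm.mul hφm.exp).aestronglyMeasurable (ae_of_all _ fun x => ?_)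
    rw [Real.norm_eq_abs, abs_mul, abs_of_pos (exp_pos _)]
  have h1' : Integrable (fun x => |ψ x| * exp (φ (x.1, -x.2))) μ₀ := by
    have h := (integrable_comp_flip_iff μ₀ hinv (fun x => |ψ x| * exp (φ x))).2 h1
    refine h.congr (ae_of_all _ fun x => ?_)
    simp only [hψodd x, abs_neg]
  have ht := integrable_triangular μ₀ hinv hφm hexp
  set g : PhaseSpace N → ℝ := fun x => |ψ x| * (exp (φ x) + exp (φ (x.1, -x.2))) / 2 with hg
  have hgi : Integrable g μ₀ := by
    refine ((h1.add h1').div_const 2).congr (ae_of_all _ fun x => ?_)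
    simp only [hg, Pi.add_apply]
    ring
  have hgA : Integrable (A.indicator g) μ₀ := hgi.indicator hAm
  -- the value
  obtain ⟨hfin, hval⟩ := toReal_klDiv_flip_tilted_eq_half_integral μ₀ hinv hφm hexp hZ1 hw
  refine ⟨hfin, ?_⟩
  rw [hval, ← integral_const_mul]
  -- pointwise split at the level set
  have hpt : ∀ x, (1 / 2 : ℝ) * (ψ x * (exp (φ x) - exp (φ (x.1, -x.2)))) ≤
      (1 + η / 2) * ((exp (φ x) - exp (φ (x.1, -x.2))) ^ 2 / (exp (φ x) + exp (φ (x.1, -x.2)))) +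
        A.indicator g x := by
    intro x
    have ht0 := triangular_nonneg (φ x) (φ (x.1, -x.2))
    by_cases hx : x ∈ A
    · rw [Set.indicator_of_mem hx]
      have h := half_sub_mul_le_abs_mul_add (φ x) (φ (x.1, -x.2))
      have : 0 ≤ (1 + η / 2) * ((exp (φ x) - exp (φ (x.1, -x.2))) ^ 2 /
          (exp (φ x) + exp (φ (x.1, -x.2)))) := by positivity
      simp only [hg, hψ] at h ⊢
      linarith
    · rw [Set.indicator_of_notMem hx, add_zero]
      have hle : |ψ x| ≤ η := by
        simp only [hA, Set.mem_setOf_eq, not_lt] at hx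
        exact hx
      have h := half_sub_mul_le_triangular (φ x) (φ (x.1, -x.2))
      have h2 : (1 + |ψ x| / 2) * ((exp (φ x) - exp (φ (x.1, -x.2))) ^ 2 /
          (exp (φ x) + exp (φ (x.1, -x.2)))) ≤
          (1 + η / 2) * ((exp (φ x) - exp (φ (x.1, -x.2))) ^ 2 /
          (exp (φ x) + exp (φ (x.1, -x.2)))) :=
        mul_le_mul_of_nonneg_right (by linarith) ht0
      simp only [hψ] at h h2 ⊢
      linarith
  have hw' : Integrable (fun x => ψ x * exp (φ (x.1, -x.2))) μ₀ := by
    have h := (integrable_comp_flip_iff μ₀ hinv (fun x => -(ψ x * exp (φ x)))).2 hw.neg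
    refine h.congr (ae_of_all _ fun x => ?_)
    simp only [hψodd x]
    ring
  have hk : Integrable (fun x => (1 / 2 : ℝ) * (ψ x * (exp (φ x) - exp (φ (x.1, -x.2))))) μ₀ := by
    refine ((hw.sub hw').const_mul (1 / 2 : ℝ)).congr (ae_of_all _ fun x => ?_)
    simp only [Pi.sub_apply]
    ring
  have hR : Integrable (fun x => (1 + η / 2) * ((exp (φ x) - exp (φ (x.1, -x.2))) ^ 2 /
      (exp (φ x) + exp (φ (x.1, -x.2)))) + A.indicator g x) μ₀ := (ht.const_mul _).add hgA
  refine (integral_mono hk hR hpt).trans (le_of_eq ?_)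
  rw [integral_add (ht.const_mul _) hgA, integral_const_mul, integral_indicator hAm]
  congr 1
  -- `∫_A g dμ₀ = ∫_A |ψ| e^{φ} dμ₀`: the flipped half equals the unflipped one
  set G : PhaseSpace N → ℝ := fun x => |ψ x| * exp (φ x) with hG
  have hflip : ∫ x, A.indicator (fun x => |ψ x| * exp (φ (x.1, -x.2))) x ∂μ₀ =
      ∫ x, A.indicator G x ∂μ₀ := by
    rw [← integral_comp_flip μ₀ hinv (A.indicator G)]
    refine integral_congr_ae (ae_of_all _ fun x => ?_)
    change A.indicator (fun x => |ψ x| * exp (φ (x.1, -x.2))) x = A.indicator G (x.1, -x.2)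
    by_cases hx : x ∈ A
    · have hxΘ : (x.1, -x.2) ∈ A := by rw [hAΘ x]; exact hx
      rw [Set.indicator_of_mem hxΘ, Set.indicator_of_mem hx, hG]
      simp only [hψodd x, abs_neg]
    · have hxΘ : (x.1, -x.2) ∉ A := by rw [hAΘ x]; exact hx
      rw [Set.indicator_of_notMem hxΘ, Set.indicator_of_notMem hx]
  rw [← integral_indicator hAm, ← integral_indicator hAm]
  have hsplit : ∀ x, A.indicator g x =
      (A.indicator G x + A.indicator (fun x => |ψ x| * exp (φ (x.1, -x.2))) x) / 2 := by
    intro x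
    by_cases hx : x ∈ A
    · simp only [Set.indicator_of_mem hx, hg, hG]
      ring
    · simp only [Set.indicator_of_notMem hx]
      ring
  rw [integral_congr_ae (ae_of_all _ hsplit), integral_div,
    integral_add (h1.indicator hAm) (h1'.indicator hAm), hflip]
  ring

end OneState

end Summit.AtomisticToContinuum.FouriersLaw.Theorems.ExtensiveSnapshotIrreversibility.EnergyWindow

end
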